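import Summits.QuantumFields.YangMills.Theorems.BalabanUVNodesN12RootTransporterBj
import Literature.MathematicalPhysics.QuantumFieldTheory.Balaban1983to89.B15Prop1MinimiserTowerAxialGauge
import HarnessLib

/-!
# BalabanUVNodes ∕ N12 — THE ROOT-TRANSPORTER LETTER `hT` AT THE ENDPOINT's OBJECTS (record edition): for a (2.12) minimiser `U₀` of the data `M˙(Q_k^{s*}W)` on `𝐁_k(Z)` at the averaging of record
# (`SU(2)`, exp[mean log]), the member-average letter of `…N12RootTransporterBj.rootTransporter_Bj` IS the DATUM letter by the constraint (2.12), and the monotonicity of the tower budgets follows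
# from `0 ≤ κ` — the second layer of dag-n12-w6's `B15Prop1InteriorLetterCorridor.interiorLetter_corridor_atRecord`, [Balaban1985Variational] (16)–(18) between the points of `𝔅_k`

Cell `pub-ymgap` (HUMAN RULINGS D-0062 ∕ D-0149), WIDTH SEAT `pub-ymgap-dag-n12-w3` g4 (node N12 = [B15]; key K1⁹ `stmt-QuantumFields-27364` (KEY MAP v2), `--kind proof --supports … --as
helper`; count-neutral).  THEOREMS ONLY (0 `def`, 0 `instance`, 0 `sorry`); consumed BY NAME: this lineage's `N12RootTransporterBj.rootTransporter_Bj` ∕ `theta_mono_of_nonneg`; the record's objects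
(`Node00.avOfRecord F 2 Kt = blockAvg expMeanLogSU` (`rfl`), `B15DeterminingSets.IsMinimizer` ∕ `avgFamily` = [III] (2.11)–(2.12), `qsstarGIter0` = [III] (1.3) `Q_k^{s*}`).

WHY.  `B15Prop1InteriorLetterCorridor.interiorLetter_corridor_atRecord` (dag-n12-w6 g2, p638071) displays `hT` for `U₀ : GaugeField (F.P Kt) 0 SU2` at `Ω₁(Z) = maxDomT ν.M₁ Z 1`:
`∀ b, b₋ ∈ Ω₁ → b₊ ∈ Ω₁ → root b₋ ≠ root b₊ → ∃ Ω g, walkEnd (root b₋) Ω = root b₊ ∧ |Ω| ≤ ℓT ∧ dist1 (𝒰_{U₀}(walk (root b₋) Ω)·g⁻¹) ≤ eT ∧ dist1 g ≤ dG`.  `rootTransporter_Bj` inhabits it for any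
fine configuration modulo the member-average letter `dist1 (M^i(U₀)(c)) ≤ δ₁`; for the (2.12) MINIMISER of the data `V = M˙(Q_k^{s*}W)` the constraint `M_𝐁(U₀) = V` ([III] (2.12), `AgreeOn`) makes
that letter the DATUM letter `dist1 (V_i(c)) ≤ δ₁` on the members — which `B15Prop1MinimiserTowerAxialGauge` §5 reads off the shadow values of `W` per level (`1` inside a block, `W⟨B^{k−i}c₋, μ⟩`
across a face).  THIS FILE: ★★★ `rootTransporter_atRecord` — `hT` with `(ℓT, eT, dG) = (m·L^k, m·θ_k, m·δ₁)`, `m = 3·d·(L−1)∕2 + 5`, DISPLAYING only dag-n12-w2's segment corr-factor letter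
`hκ` (correction factors of [Balaban1987RG1] (0.4) of the iterated averages `M^{i′}(U₀)` met on the member segments, budgets `0 ≤ κ_i`, `κ_i + L·θ_i ≤ θ_{i+1}`, `0 ≤ θ_0`) and the datum letter
`hWj` (p622221 §6's shape, all levels `≤ k`); `rootTransporter_atRecord_linear` — the budgets linear in a guard `eR` give `eT ≤ CT·eR`, `dG ≤ CG·eR` (the `hΘc`-type inputs of the first layer).

HONEST FRAMING.  Bookkeeping by name around landed theorems; no estimate of Bałaban's asserted; `hκ`, `hWj`, the forest∕root map, the minimiser ([15] Thm 1) stay DISPLAYED; N12 NOT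
discharged; K1⁹ NOT closed; counts unmoved (typed 28∕28 · discharged 5∕27); one finite 𝕋⁴ programme at fixed ε — R4 closes the conditional rung `BalabanLadder.UV` only; the Yang–Mills
mass gap (Clay) is NOT proved by any of this; nothing continuum ∕ ℝ⁴ ∕ OS.
-/

noncomputable section

namespace Summit.QuantumFields.YangMills.BalabanUVNodes.N12RootTransporterAtRecord

open scoped BigOperators
open Literature.MathematicalPhysics.QuantumFieldTheory.Balaban1983to89
open T4Continuum BlockAveraging
open B15DeterminingSets
open T4CubeChartGnomonic (SU2)
open B5Eq118OneStroke (iterBlockOf)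
open B14.Eq213MaximalDomains (side)
open B14.Eq213DetSet (Bj maxDomT)
open ExpMeanLog (expMeanLogSU deltaSU)
open Literature.MathematicalPhysics.QuantumFieldTheory.BalabanImbrieJaffe1984to88.BIJ85Eq453GaugeField (qsstarGIter0)
open Summit.QuantumFields.YangMills.BalabanUVNodes.N12RootTransporterBj (rootTransporter_Bj rootTransporter_Bj_graded theta_mono_of_nonneg)

/-- ★★★ **THE ROOT-TRANSPORTER LETTER AT THE RECORD, FOR THE (2.12) MINIMISER.**  Objects of the endpoint: the torus `F.P Kt`, numerics `ν` (`M₁ = ν.M₁ ≥ 2`, cover divisibility), `1 ≤ k ≤ m + K`,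
`Ω₁(Z) = maxDomT ν.M₁ Z 1`, the determining set `𝐁_k(Z) = Bj ν.M₁ Z k`, the averaging of record (`SU(2)`, exp[mean log]), a `k`-field `W` generating the data `M˙(Q_k^{s*}W)`, a minimiser
`U₀` of (2.12) for these data in any class `reg`, a root map with p635000's (CENTRE) clause.  DISPLAYED: dag-n12-w2's tower budgets `κ ≥ 0`, `θ` (`0 ≤ θ_0`, `κ_i + L·θ_i ≤ θ_{i+1}`) with the
segment corr-factor letter on the members of `𝐁_k(Z)`, and the DATUM letter `dist1 ((M˙(Q_k^{s*}W))_i(c)) ≤ δ₁` on the members (levels `≤ k`).  THEN `hT` of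
`B15Prop1InteriorLetterCorridor.interiorLetter_corridor_atRecord` holds with `ℓT = m·L^k`, `eT = m·θ_k`, `dG = m·δ₁`, `m = 3·d·(L−1)∕2 + 5`.
[cite: Balaban1985Variational, (3)–(4) p.278, (16)–(18) p.280; Balaban1985RegularSpaces, (1.19) p.79; Balaban1988Convergent, (2.12)–(2.13) pp.256–257, (2.16) p.257; Balaban1987RG1, (0.4) p.253] -/
theorem rootTransporter_atRecord {F : T4Family} (ν : Node00.Stage7Numerics) (Kt : ℕ) {k : ℕ} (hk1 : 1 ≤ k) (hk : k ≤ (F.P Kt).m + (F.P Kt).K)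
    (hM2 : 2 ≤ ν.M₁) (hdiv : side (F.P Kt).L ν.M₁ k ∣ (F.P Kt).sitesPerDir 0) (Z : Set (Site (F.P Kt) 0))
    (root : Site (F.P Kt) 0 → Site (F.P Kt) 0)
    (hcentre : ∀ (z : Site (F.P Kt) 0) (J : ℕ), iterBlockOf J z ∈ (Bj ν.M₁ Z k : DetSet (F.P Kt)) J →
      ((1 ≤ J ∧ ∃ c ∈ bondsOf ((Bj ν.M₁ Z k : DetSet (F.P Kt)) (J - 1)), (iterBlockOf (J - 1) z = c.src ∨ iterBlockOf (J - 1) z = c.tgt)) ∧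
          root z = embIter (J - 1) (iterBlockOf (J - 1) z)) ∨
      (¬ (1 ≤ J ∧ ∃ c ∈ bondsOf ((Bj ν.M₁ Z k : DetSet (F.P Kt)) (J - 1)), (iterBlockOf (J - 1) z = c.src ∨ iterBlockOf (J - 1) z = c.tgt)) ∧
          root z = embIter J (iterBlockOf J z)))
    {reg : Set (GaugeField (F.P Kt) 0 SU2)} (W : GaugeField (F.P Kt) k SU2) {U₀ : GaugeField (F.P Kt) 0 SU2}
    (hmin : IsMinimizer (Node00.avOfRecord F 2 Kt) reg (Bj ν.M₁ Z k) (avgFamily (Node00.avOfRecord F 2 Kt) (qsstarGIter0 k W)) U₀)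
    (κ θ : ℕ → ℝ) (hθ0 : 0 ≤ θ 0) (hκ0 : ∀ i, 0 ≤ κ i) (hθ : ∀ i, κ i + (F.P Kt).L * θ i ≤ θ (i + 1))
    -- DISPLAYED: the segment corr-factor letter ([Balaban1987RG1] (0.4)) on the members of `𝐁_k(Z)`, dag-n12-w2's currency
    (hκ : ∀ i ≤ k, ∀ c ∈ bondsOf ((Bj ν.M₁ Z k : DetSet (F.P Kt)) i), ∀ i' < i, ∀ c' : PBond (F.P Kt) (i' + 1), c'.dir = c.dir →
      (∃ t < (F.P Kt).L ^ i, embIter (i' + 1) c'.src = (fun z : Site (F.P Kt) 0 => z.shift c.dir)^[t] (embIter i c.src)) →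
      dist1 (corr (expMeanLogSU (n := Fin 2)) (avgFamily (Node00.avOfRecord F 2 Kt) U₀ i') c') ≤ κ i')
    -- DISPLAYED: the datum letter at the members (levels `≤ k`), p622221 §6's shape
    {δ₁ : ℝ} (hWj : ∀ i ≤ k, ∀ c ∈ bondsOf ((Bj ν.M₁ Z k : DetSet (F.P Kt)) i), dist1 (avgFamily (Node00.avOfRecord F 2 Kt) (qsstarGIter0 k W) i c) ≤ δ₁) :
    ∀ b : PBond (F.P Kt) 0, b.src ∈ maxDomT ν.M₁ Z 1 → b.tgt ∈ maxDomT ν.M₁ Z 1 → root b.src ≠ root b.tgt →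
      ∃ (Ωw : List (Letter (F.P Kt).d)) (g : SU2), walkEnd (root b.src) Ωw = root b.tgt ∧
        Ωw.length ≤ (3 * ((F.P Kt).d * (((F.P Kt).L - 1) / 2)) + 5) * (F.P Kt).L ^ k ∧
        dist1 (holAt U₀ (walk (root b.src) Ωw) * g⁻¹) ≤ ((3 * ((F.P Kt).d * (((F.P Kt).L - 1) / 2)) + 5 : ℕ) : ℝ) * θ k ∧
        dist1 g ≤ ((3 * ((F.P Kt).d * (((F.P Kt).L - 1) / 2)) + 5 : ℕ) : ℝ) * δ₁ := by
  -- the member-average letter IS the datum letter, by the constraint (2.12)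
  have hδ₁ : ∀ i ≤ k, ∀ c ∈ bondsOf ((Bj ν.M₁ Z k : DetSet (F.P Kt)) i),
      dist1 (Averaging.iter (fun i => blockAvg (P := F.P Kt) (j := i) (expMeanLogSU (n := Fin 2))) i U₀ c) ≤ δ₁ := fun i hi c hc => by
    have hagree : avgFamily (Node00.avOfRecord F 2 Kt) U₀ i c = avgFamily (Node00.avOfRecord F 2 Kt) (qsstarGIter0 k W) i c := hmin.2.1 i c hc
    show dist1 (avgFamily (Node00.avOfRecord F 2 Kt) U₀ i c) ≤ δ₁
    rw [hagree]
    exact hWj i hi c hc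
  exact rootTransporter_Bj hk hk1 hM2 hdiv root hcentre (expMeanLogSU (n := Fin 2)) U₀ κ θ hθ0 hθ (fun i hi => (theta_mono_of_nonneg κ θ hθ0 hκ0 hθ hi).2)
    (fun i hi c hc i' hi' c' hdir hseg => hκ i hi c hc i' hi' c' hdir hseg) hδ₁

/-- ★★★ **PLAQUETTE EDITION**: the segment corr-factor letter discharged from PLAQUETTE SMALLNESS OF THE ITERATED AVERAGES near the member segments (dag-n12-w2's
`BlockAveragingPlaquetteBoundLocal.dist1_corr_le_local`: `κ_j := 6·(((d+2)L)²∕4)·a_j` when every level-`j` plaquette of `M^j(U₀)` based in the three blocks around a level-`(j+1)` bond of the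
segment is `a_j`-small, `(((d+2)L)²∕4)·a_j < δ_{SU(2)}`).  DISPLAYED: that plaquette letter (the CALLER iterates [Balaban1985Averaging] Prop. 1∕2 in local form up the tower, e.g.
`…N11LocalIteratedAveraging`) and the datum letter `hWj`.  Conclusion: `hT` with `(ℓT, eT, dG) = (m·L^k, m·θ_k, m·δ₁)`, `6·(((d+2)L)²∕4)·a_j + L·θ_j ≤ θ_{j+1}`, `0 ≤ θ_0`.
[cite: Balaban1985Variational, (16)–(18) p.280; Balaban1985Averaging, (26)–(27) p.22; Balaban1987RG1, (0.4) and (0.11) p.253; Balaban1988Convergent, (2.12)–(2.13) pp.256–257] -/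
theorem rootTransporter_atRecord_of_plaqSmall {F : T4Family} (ν : Node00.Stage7Numerics) (Kt : ℕ) {k : ℕ} (hk1 : 1 ≤ k) (hk : k ≤ (F.P Kt).m + (F.P Kt).K)
    (hM2 : 2 ≤ ν.M₁) (hdiv : side (F.P Kt).L ν.M₁ k ∣ (F.P Kt).sitesPerDir 0) (Z : Set (Site (F.P Kt) 0))
    (root : Site (F.P Kt) 0 → Site (F.P Kt) 0)
    (hcentre : ∀ (z : Site (F.P Kt) 0) (J : ℕ), iterBlockOf J z ∈ (Bj ν.M₁ Z k : DetSet (F.P Kt)) J →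
      ((1 ≤ J ∧ ∃ c ∈ bondsOf ((Bj ν.M₁ Z k : DetSet (F.P Kt)) (J - 1)), (iterBlockOf (J - 1) z = c.src ∨ iterBlockOf (J - 1) z = c.tgt)) ∧
          root z = embIter (J - 1) (iterBlockOf (J - 1) z)) ∨
      (¬ (1 ≤ J ∧ ∃ c ∈ bondsOf ((Bj ν.M₁ Z k : DetSet (F.P Kt)) (J - 1)), (iterBlockOf (J - 1) z = c.src ∨ iterBlockOf (J - 1) z = c.tgt)) ∧
          root z = embIter J (iterBlockOf J z)))
    {reg : Set (GaugeField (F.P Kt) 0 SU2)} (W : GaugeField (F.P Kt) k SU2) {U₀ : GaugeField (F.P Kt) 0 SU2}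
    (hmin : IsMinimizer (Node00.avOfRecord F 2 Kt) reg (Bj ν.M₁ Z k) (avgFamily (Node00.avOfRecord F 2 Kt) (qsstarGIter0 k W)) U₀)
    (a θ : ℕ → ℝ) (hθ0 : 0 ≤ θ 0) (ha0 : ∀ j, 0 ≤ a j)
    (haN : ∀ j < k, (((((F.P Kt).d + 2) * (F.P Kt).L : ℕ) : ℝ) ^ 2 / 4) * a j < deltaSU (Fin 2))
    (hθ : ∀ j, 6 * ((((((F.P Kt).d + 2) * (F.P Kt).L : ℕ) : ℝ) ^ 2 / 4) * a j) + (F.P Kt).L * θ j ≤ θ (j + 1))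
    -- DISPLAYED: the plaquettes of the iterated averages `M^j(U₀)` in the three blocks around every level-`(j+1)` bond of a member segment are `a_j`-small
    (ha : ∀ i ≤ k, ∀ c ∈ bondsOf ((Bj ν.M₁ Z k : DetSet (F.P Kt)) i), ∀ j < i, ∀ c' : PBond (F.P Kt) (j + 1), c'.dir = c.dir →
      (∃ s < (F.P Kt).L ^ i, embIter (j + 1) c'.src = (fun z : Site (F.P Kt) 0 => z.shift c.dir)^[s] (embIter i c.src)) →
      ∀ q : Plaq (F.P Kt) j, (blockOf q.src = c'.src.unshift c'.dir ∨ blockOf q.src = c'.src ∨ blockOf q.src = c'.tgt) →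
        dist1 (GaugeField.plaqHol (avgFamily (Node00.avOfRecord F 2 Kt) U₀ j) q) < a j)
    -- DISPLAYED: the datum letter at the members (levels `≤ k`)
    {δ₁ : ℝ} (hWj : ∀ i ≤ k, ∀ c ∈ bondsOf ((Bj ν.M₁ Z k : DetSet (F.P Kt)) i), dist1 (avgFamily (Node00.avOfRecord F 2 Kt) (qsstarGIter0 k W) i c) ≤ δ₁) :
    ∀ b : PBond (F.P Kt) 0, b.src ∈ maxDomT ν.M₁ Z 1 → b.tgt ∈ maxDomT ν.M₁ Z 1 → root b.src ≠ root b.tgt →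
      ∃ (Ωw : List (Letter (F.P Kt).d)) (g : SU2), walkEnd (root b.src) Ωw = root b.tgt ∧
        Ωw.length ≤ (3 * ((F.P Kt).d * (((F.P Kt).L - 1) / 2)) + 5) * (F.P Kt).L ^ k ∧
        dist1 (holAt U₀ (walk (root b.src) Ωw) * g⁻¹) ≤ ((3 * ((F.P Kt).d * (((F.P Kt).L - 1) / 2)) + 5 : ℕ) : ℝ) * θ k ∧
        dist1 g ≤ ((3 * ((F.P Kt).d * (((F.P Kt).L - 1) / 2)) + 5 : ℕ) : ℝ) * δ₁ := by
  refine rootTransporter_atRecord ν Kt hk1 hk hM2 hdiv Z root hcentre W hmin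
    (fun j => 6 * ((((((F.P Kt).d + 2) * (F.P Kt).L : ℕ) : ℝ) ^ 2 / 4) * a j)) θ hθ0 (fun j => ?_) hθ ?_ hWj
  · have h1 : (0 : ℝ) ≤ (((((F.P Kt).d + 2) * (F.P Kt).L : ℕ) : ℝ) ^ 2 / 4) := by positivity
    have := mul_nonneg h1 (ha0 j)
    linarith
  · intro i hi c hc j hj c' hdir hs
    exact BlockAveragingPlaquetteBoundLocal.dist1_corr_le_local (ha0 j) (by omega) c' (ha i hi c hc j hj c' hdir hs) (haN j (lt_of_lt_of_le hj hi))

/-- ★★★ **PLAQUETTE EDITION, GRADED BY THE LEVEL OF THE BOND** (dag-n12-w6's LOCATED-GRADING ∕ dag-n12-c's LOCATED-PLAQ): the same data as `rootTransporter_atRecord_of_plaqSmall`; for a fine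
bond `b` inside `Ω₁(Z)` whose source has `Γ`-level `J` the word runs at levels `≤ min(J + 1, k)` (`N12RootTransporterBj.rootTransporter_Bj_graded`): `|Ω| ≤ m·L^{min(J+1,k)}`,
`dist1 (𝒰_{U₀}(walk (root b₋) Ω)·g⁻¹) ≤ m·θ_{min(J+1,k)}`, `dist1 g ≤ m·δ₁` — the per-bond transporter budget `ℓb b := m·L^{min(J(b)+1,k)}` of the graded first layer.
[cite: Balaban1985Variational, (16)–(18) p.280; Balaban1985RegularSpaces, (1.7) p.77, (1.19) p.79; Balaban1985Averaging, (26)–(27) p.22; Balaban1988Convergent, (2.12)–(2.13) pp.256–257] -/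
theorem rootTransporter_atRecord_graded_of_plaqSmall {F : T4Family} (ν : Node00.Stage7Numerics) (Kt : ℕ) {k : ℕ} (hk1 : 1 ≤ k) (hk : k ≤ (F.P Kt).m + (F.P Kt).K)
    (hM2 : 2 ≤ ν.M₁) (hdiv : side (F.P Kt).L ν.M₁ k ∣ (F.P Kt).sitesPerDir 0) (Z : Set (Site (F.P Kt) 0))
    (root : Site (F.P Kt) 0 → Site (F.P Kt) 0)
    (hcentre : ∀ (z : Site (F.P Kt) 0) (J : ℕ), iterBlockOf J z ∈ (Bj ν.M₁ Z k : DetSet (F.P Kt)) J →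
      ((1 ≤ J ∧ ∃ c ∈ bondsOf ((Bj ν.M₁ Z k : DetSet (F.P Kt)) (J - 1)), (iterBlockOf (J - 1) z = c.src ∨ iterBlockOf (J - 1) z = c.tgt)) ∧
          root z = embIter (J - 1) (iterBlockOf (J - 1) z)) ∨
      (¬ (1 ≤ J ∧ ∃ c ∈ bondsOf ((Bj ν.M₁ Z k : DetSet (F.P Kt)) (J - 1)), (iterBlockOf (J - 1) z = c.src ∨ iterBlockOf (J - 1) z = c.tgt)) ∧
          root z = embIter J (iterBlockOf J z)))
    {reg : Set (GaugeField (F.P Kt) 0 SU2)} (W : GaugeField (F.P Kt) k SU2) {U₀ : GaugeField (F.P Kt) 0 SU2}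
    (hmin : IsMinimizer (Node00.avOfRecord F 2 Kt) reg (Bj ν.M₁ Z k) (avgFamily (Node00.avOfRecord F 2 Kt) (qsstarGIter0 k W)) U₀)
    (a θ : ℕ → ℝ) (hθ0 : 0 ≤ θ 0) (ha0 : ∀ j, 0 ≤ a j)
    (haN : ∀ j < k, (((((F.P Kt).d + 2) * (F.P Kt).L : ℕ) : ℝ) ^ 2 / 4) * a j < deltaSU (Fin 2))
    (hθ : ∀ j, 6 * ((((((F.P Kt).d + 2) * (F.P Kt).L : ℕ) : ℝ) ^ 2 / 4) * a j) + (F.P Kt).L * θ j ≤ θ (j + 1))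
    -- DISPLAYED: the plaquettes of the iterated averages `M^j(U₀)` in the three blocks around every level-`(j+1)` bond of a member segment are `a_j`-small
    (ha : ∀ i ≤ k, ∀ c ∈ bondsOf ((Bj ν.M₁ Z k : DetSet (F.P Kt)) i), ∀ j < i, ∀ c' : PBond (F.P Kt) (j + 1), c'.dir = c.dir →
      (∃ s < (F.P Kt).L ^ i, embIter (j + 1) c'.src = (fun z : Site (F.P Kt) 0 => z.shift c.dir)^[s] (embIter i c.src)) →
      ∀ q : Plaq (F.P Kt) j, (blockOf q.src = c'.src.unshift c'.dir ∨ blockOf q.src = c'.src ∨ blockOf q.src = c'.tgt) →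
        dist1 (GaugeField.plaqHol (avgFamily (Node00.avOfRecord F 2 Kt) U₀ j) q) < a j)
    -- DISPLAYED: the datum letter at the members (levels `≤ k`)
    {δ₁ : ℝ} (hWj : ∀ i ≤ k, ∀ c ∈ bondsOf ((Bj ν.M₁ Z k : DetSet (F.P Kt)) i), dist1 (avgFamily (Node00.avOfRecord F 2 Kt) (qsstarGIter0 k W) i c) ≤ δ₁) :
    ∀ b : PBond (F.P Kt) 0, b.src ∈ maxDomT ν.M₁ Z 1 → b.tgt ∈ maxDomT ν.M₁ Z 1 → root b.src ≠ root b.tgt →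
      ∀ J : ℕ, iterBlockOf J b.src ∈ (Bj ν.M₁ Z k : DetSet (F.P Kt)) J →
      ∃ (Ωw : List (Letter (F.P Kt).d)) (g : SU2), walkEnd (root b.src) Ωw = root b.tgt ∧
        Ωw.length ≤ (3 * ((F.P Kt).d * (((F.P Kt).L - 1) / 2)) + 5) * (F.P Kt).L ^ min (J + 1) k ∧
        dist1 (holAt U₀ (walk (root b.src) Ωw) * g⁻¹) ≤ ((3 * ((F.P Kt).d * (((F.P Kt).L - 1) / 2)) + 5 : ℕ) : ℝ) * θ (min (J + 1) k) ∧
        dist1 g ≤ ((3 * ((F.P Kt).d * (((F.P Kt).L - 1) / 2)) + 5 : ℕ) : ℝ) * δ₁ := by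
  -- the member-average letter IS the datum letter, by the constraint (2.12)
  have hδ₁ : ∀ i ≤ k, ∀ c ∈ bondsOf ((Bj ν.M₁ Z k : DetSet (F.P Kt)) i),
      dist1 (Averaging.iter (fun i => blockAvg (P := F.P Kt) (j := i) (expMeanLogSU (n := Fin 2))) i U₀ c) ≤ δ₁ := fun i hi c hc => by
    have hagree : avgFamily (Node00.avOfRecord F 2 Kt) U₀ i c = avgFamily (Node00.avOfRecord F 2 Kt) (qsstarGIter0 k W) i c := hmin.2.1 i c hc
    show dist1 (avgFamily (Node00.avOfRecord F 2 Kt) U₀ i c) ≤ δ₁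
    rw [hagree]
    exact hWj i hi c hc
  have hκ0 : ∀ j, 0 ≤ 6 * ((((((F.P Kt).d + 2) * (F.P Kt).L : ℕ) : ℝ) ^ 2 / 4) * a j) := fun j => by
    have h1 : (0 : ℝ) ≤ (((((F.P Kt).d + 2) * (F.P Kt).L : ℕ) : ℝ) ^ 2 / 4) := by positivity
    have := mul_nonneg h1 (ha0 j)
    linarith
  exact rootTransporter_Bj_graded hk hk1 hM2 hdiv root hcentre (expMeanLogSU (n := Fin 2)) U₀ (fun j => 6 * ((((((F.P Kt).d + 2) * (F.P Kt).L : ℕ) : ℝ) ^ 2 / 4) * a j)) θ hθ0 hθ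
    (fun i j hij => (theta_mono_of_nonneg _ θ hθ0 hκ0 hθ hij).2)
    (fun i hi c hc j hj c' hdir hs => BlockAveragingPlaquetteBoundLocal.dist1_corr_le_local (ha0 j) (by omega) c' (ha i hi c hc j hj c' hdir hs) (haN j (lt_of_lt_of_le hj hi)))
    hδ₁

/-- ★ **LINEAR MODULI**: if `θ_k ≤ Cθ·eR` and `δ₁ ≤ Cδ·eR` then `eT = m·θ_k ≤ (m·Cθ)·eR` and `dG = m·δ₁ ≤ (m·Cδ)·eR` — the shape of the `hΘc` inputs of the first layer
(`B15Prop1InteriorLetterCorridor.interiorLetter_corridor_linear`). [cite: Balaban1989LargeFieldI, Prop. 1 p.194 («for ε > 0 sufficiently small»); Balaban1985Variational, (16)–(18) p.280] -/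
theorem rootTransporter_atRecord_linear {m : ℕ} {θk δ₁ Cθ Cδ eR : ℝ} (hθ : θk ≤ Cθ * eR) (hδ : δ₁ ≤ Cδ * eR) :
    (m : ℝ) * θk ≤ ((m : ℝ) * Cθ) * eR ∧ (m : ℝ) * δ₁ ≤ ((m : ℝ) * Cδ) * eR := by
  have hm : (0 : ℝ) ≤ m := Nat.cast_nonneg m
  constructor
  · rw [mul_assoc]; exact mul_le_mul_of_nonneg_left hθ hm
  · rw [mul_assoc]; exact mul_le_mul_of_nonneg_left hδ hm

end Summit.QuantumFields.YangMills.BalabanUVNodes.N12RootTransporterAtRecord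

end
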